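import Literature.MathematicalPhysics.QuantumLattice.SpinChains
import Literature.MathematicalPhysics.QuantumLattice.MatrixProductStatesAkltParentProofs
import HarnessLib

/-!
# Discharged fact: the MPS parent Hamiltonian of the AKLT tensor is `½ H_AKLT + L/3`

Sibling proof file of `Literature/MathematicalPhysics/QuantumLattice/SpinChains.lean` (theorem-only;
no statement or definition is introduced or changed). It discharges the named fact
(`def X : Prop`, D-0014)

* `Literature.MathematicalPhysics.QuantumLattice.parentHamiltonian_akltTensor_eq_akltRing` — for
  `2 ≤ L`, on the ring `ℤ/L`, `parentHamiltonian L 2 akltTensor = ½ • akltRing L + (L/3) • 1`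
  (`parentHamiltonian_akltTensor_eq_akltRing_holds`).

## Source

I. Affleck, T. Kennedy, E. H. Lieb, H. Tasaki, *Valence bond ground states in isotropic quantum
antiferromagnets*, Comm. Math. Phys. **115** (1988) 477–528: eq. (1.1), p. 478 — the AKLT chain
`H = Σ_i [𝐒_i · 𝐒_{i+1} + ⅓ (𝐒_i · 𝐒_{i+1})²]` (the case `β = -1/3` of eq. (1.2), p. 479); §2.1,
eq. (2.1), p. 481 — the orthogonal projection onto bond spin `2` is
`P₂(𝐒_i + 𝐒_{i+1}) = ½ 𝐒_i · 𝐒_{i+1} + ⅙ (𝐒_i · 𝐒_{i+1})² + ⅓`; eq. (2.2), p. 481 — "The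
Hamiltonian is the sum over `i` of these projections", `H = Σ_i H_i`, `H_i = P₂(𝐒_i + 𝐒_{i+1})`.
Hence `Σ_i P₂(i, i+1) = ½ H_{(1.1)} + L/3` on the ring of `L` sites. That `Σ_i P₂(i, i+1)` is the
block-length-`2` MPS parent Hamiltonian of the AKLT tensor is Fannes–Nachtergaele–Werner, CMP
**144** (1992), eq. (1.1) p. 445 and §7 pp. 485–486, discharged in the tree as
`parentHamiltonian_akltTensor_eq_holds` (`MatrixProductStatesAkltParentProofs.lean`).

## Proof

`parentHamiltonian_akltTensor_eq_holds` gives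
`parentHamiltonian L 2 akltTensor = Σ_i (⅙ (𝐒_i · 𝐒_{i+1})² + ½ 𝐒_i · 𝐒_{i+1} + ⅓ · 1)`; splitting
off the constant summand (`Finset.sum_add_distrib`, `Finset.sum_const`, `|ℤ/L| = L`) and comparing
summands with `½ • akltBond i (i+1) = ½ 𝐒_i · 𝐒_{i+1} + ⅙ (𝐒_i · 𝐒_{i+1})²` (`module`) gives the
claim. No new facts are introduced (net debt delta `-1`).
-/

noncomputable section

open Matrix Complex Finset

namespace Literature.MathematicalPhysics.QuantumLattice

section AKLT

/-- **Discharge of `parentHamiltonian_akltTensor_eq_akltRing`.** For `2 ≤ L`, on the ring `ℤ/L`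
the block-length-`2` MPS parent Hamiltonian of the AKLT tensor is
`Σ_i P₂(i, i+1) = ½ H_AKLT + L/3`, where `H_AKLT = akltRing L = Σ_i (𝐒_i · 𝐒_{i+1} + ⅓ (𝐒_i · 𝐒_{i+1})²)`
and `P₂(i, i+1) = ½ 𝐒_i · 𝐒_{i+1} + ⅙ (𝐒_i · 𝐒_{i+1})² + ⅓` is the bond-spin-`2` projection.
AKLT, CMP 115 (1988): eq. (1.1) p. 478, eqs. (2.1)–(2.2) p. 481 ("The Hamiltonian is the sum
over `i` of these projections"); the identification of `Σ_i P₂(i, i+1)` with the parent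
Hamiltonian is `parentHamiltonian_akltTensor_eq_holds` (Fannes–Nachtergaele–Werner (1992),
eq. (1.1) p. 445, §7 pp. 485–486). [cite: AKLT1988, eq. (1.1) p. 478 and eqs. (2.1)–(2.2) p. 481] -/
theorem parentHamiltonian_akltTensor_eq_akltRing_holds :
    parentHamiltonian_akltTensor_eq_akltRing := by
  intro L _ hL
  rw [parentHamiltonian_akltTensor_eq_holds L hL, akltRing, Finset.smul_sum,
    Finset.sum_add_distrib, Finset.sum_const, Finset.card_univ, ZMod.card,
    ← Nat.cast_smul_eq_nsmul ℂ L, smul_smul]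
  congr 1
  · refine Finset.sum_congr rfl fun i _ => ?_
    rw [akltBond]
    module
  · rw [mul_one_div]

end AKLT

end Literature.MathematicalPhysics.QuantumLattice
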